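import Summits.QuantumFields.BalabanUV.T4Continuum.Spine.NE1p.DressedSmallFieldFamilyAmplitude
import Summits.QuantumFields.BalabanUV.T4Continuum.Spine.NE1p.DressedSmallFieldDepCoresWitnessLive

/-!
# T⁴ programme, spine estimate NE1′ (node O3b/H2) — WITNESS «N0t's RADII END FIRES — (2.28) EXERCISED IN KERNEL ON A TOY»: the owner's
# `attachedPart_locE_le_of_coresAt_pencil_radii` (N0t `Spine/NE1p/DressedSmallFieldFamilyAmplitude`) APPLIED ONCE BY NAME — a decided
# applier — on a covering-family datum whose per-family weight has the (2.15)∕(2.18) θ-FORM, with N0t's four clauses TIGHT at located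
# numerals; and N0t's μ-FAMILIES END `muPart_locE_le_of_coresAt_pencil_families` APPLIED ONCE on the same datum along the SOURCE pencil

Cell `pub-balaban`, sub-cell `t4`, row NE1′ formalisation crew (`t4/formal/NE1p/LEAVES.md` row W47 ∕ DAG N29zzo; INTENT HOME/CLAIMS.log l.18921, BOOKED typer R-T125), unit
`b2b-balaban-t4-ne1p-formalise-leaf-09` (gen 11).  ADDITIVE — imports the owner's N0t `Spine/NE1p/DressedSmallFieldFamilyAmplitude` (t4-ne1p-p1
g29; → N0s → N0r → N0q → N0p; b13's `B13FamilySum`) and this lineage's W41 PART 2 `Spine/NE1p/DressedSmallFieldDepCoresWitnessLive` (→ W41.1 →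
W35 → W33 → W24) ONLY; toy DATA `def`s + theorems; 0 `def … : Prop`, 0 cite, 0 sorry, 0 `attribute`; nothing of N0t ∕ N0s ∕ N0r ∕ W41 ∕ W35 ∕
W33 ∕ W24 ∕ b13 ∕ pv22 is restated — `coreW`, `liveTable`, `E1`, `ctr0`, `hroom0`, `Acst`, `hsmall_W`, `hsmall_mu`, `cM`, `letterMass_coreW`,
`N₁_coreW`, `budget_half`, `termAt_coreW_pencil`, `closedForm_real_sub_zero`, `norm_term_le`, `incr`, `integral_incr_pos`, `X₀`, `exp_locE_cube`,
`hrate_torus`, `torus_consts`, `K₀_four`, `coveringFamilies`, `mem_coveringFamilies`, N0s's `count_coveringFamilies_geometry`, N0t's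
`prod_radiusLetters_le` ∕ `nonempty_of_mem_coveringFamilies` are used BY NAME.

WHY.  N0t types (2.28): every polymer's τ-radius letter `θ·e^{−(1−3δ)κ d_k(Y)}` pays the table-blind majorant `α₆e^{−δκ d_k(Y)}·e^{−R(d_k(Y)+5)}`,
ONE amplitude factor `θα₆⁻¹e^{5R}` surviving per family, under the rate clause `R + δκ ≤ (1−3δ)κ` and print's p. 18 clause `θe^{5R} ≤ α₆`, and
re-fires N0s §4's families END with `hAmp` SUPPLIED from letters of that FORM (`hform`).  No module applies N0t's ENDs (W45 fires N0s §4 with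
(2.29)-shaped weights).  THIS FILE decides a θ-FORM datum and shows N0t's clauses are jointly satisfiable AND binding on pv22's torus:
* §1 LOCATED NUMERALS (toy DATA, READ OFF pv22's `torus_consts`∕`K₀_four`, none from print): `α₆T := (e·K₀(64,8)·64)⁻¹` (`h229` TIGHT;
  `α₆T = 9·A`), `δ := ⅛`, `κT := 8(κ₀ + 1)` (`hκ` TIGHT; `hRδ` with room: `3(κ₀+1) ≤ 5(κ₀+1)` at W24's located `R = 2κ₀ + 2`),
  `θT := α₆T·e^{−5R}` (`hclause` TIGHT, surviving factor `θα₆⁻¹e^{5R} = 1`);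
* §2 THE DATUM: per-family weight **`cT 𝐃 := cM r · Π_{Y∈𝐃} θT·e^{−(1−3δ)κT·d(Y)}`**, one W33 core `coreW (cT 𝐃) r` per family (`GT`), terms
  `termsT Z :=` ALL covering families of the polymer's own footprint (`foot := id`, `hmono := le_rfl` — the toy reads the families at the
  step's own scale, (2.36) KIND at factor 1; it does NOT model the L-refinement, SAID), activity `actT` along `s • liveTable`;
* §3 THE CLAUSES MET: `hform_T` with `Gc := A` (W41's `budget_half`), `hamp_T` (EQUALITY), `hκ_T`∕`hRδ_T`∕`hclause_T`∕`h229_T`; the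
  (2.29)-form `hAmp_T` for the μ-END DERIVED from `hform_T` through N0t §2 `prod_radiusLetters_le` BY NAME;
* §4 **`radiiEnd_fires`** (N0t's radii END ONCE; closed form `≤ 2·K₀(64,8)`), **`muFamiliesEnd_fires`** (N0t's μ-families END ONCE, `μ₁ ≤ 2`);
* §5 GENUINE: `singleton_mem_termsT`, **`sum_cT_le`** (the END's OWN count — N0s `count_coveringFamilies_geometry` ∘ N0t `prod_radiusLetters_le` —
  bounds the toy's total weight by `cM r·e^{−R d(Z)}`), `actT_real_sub_zero` (the increment FACTORISES: `(Σ cT)·∫ incr (t·r)`), **`actT_mu_live`**,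
  `norm_actT_X₀_lt_one`, **`radiiEnd_live`** ∕ **`muFamiliesEnd_live`** (W24 `exp_locE_cube`).

WORDING (crew row W47 = DAG N29zzo, typer R-T125: «a decided applier» of each N0t END — no «first»): «N0t's radii END and μ-families END fire ONCE each on OUR
θ-form covering-family datum; the clauses are MET because the numerals are CHOSEN tight against pv22's PROVED torus letters; (B3-amp) UNPRINTED (G-ne9p2-5)».

HONEST FRAMING.  A DECIDED TOY ([folklore]; 0 sorry; 0 citations; no `def … : Prop` — the `def`s are toy DATA and located numerals).  OUR
covering-family datum over row NE5's toy frame with W33's cores; the θ-form weight is CHOSEN so that N0t's `hform` holds — it is NOT a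
derivation of Bałaban's τ-radii (2.18) or of (2.15)'s Cauchy factors, whose identification with the cell's letters is N0t's displayed
(B1b)-READING `hform`; N0t's clauses are MET because the numerals are CHOSEN tight against pv22's PROVED torus constants — nothing of print's
`E₀, ε₁, C₁, α₄, M, q, C₂, κ₁` is instantiated; the count is N0s's kernel count of b13's PROVED (2.29) on pv22's CONSTRUCTED `tgeometry 4 N`;
`foot = id` and «all covering families» are OUR toy choices; (B3) = GAPS G-ne9p2-5 stays UNPRINTED for Bałaban's cores; 0 binders instantiated
on Bałaban's densities; no wall item; wall v1.7 (T4-DAG v43) does NOT move; R-t4r2-Q2 NOT met thereby; NE1′ ⇐ the named binders — NOT proved,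
NOT printed; spine PROVED 0∕9; count 9 unchanged.  Rung (B)+1 on ONE finite four-torus — NOT infinite volume, NOT a mass gap, NOT OS on ℝ⁴,
NOT Clay.  HONEST DEPENDENCY: continuum YM on T⁴ ⇐ BetaPertH ∧ nine spine estimates (0/9 proved); BetaPertH ⇐ (D1) ∧ (D4) ∧ CAP+tail;
G-an2-4 gates asym, D1 and NE2/3/4.
-/

noncomputable section

namespace Summit.QuantumFields.BalabanUV.T4Continuum.NE1p.DressedSmallFieldRadiiWitness

open Set Metric MeasureTheory Complex
open scoped BigOperators
open Literature.MathematicalPhysics.QuantumFieldTheory.Balaban1983to89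
open Literature.MathematicalPhysics.QuantumFieldTheory.Balaban1983to89.B12TreeDecay (K₀ K₀_pos)
open Literature.MathematicalPhysics.QuantumFieldTheory.Balaban1983to89.B13Resummation (locE Geometry)
open Literature.MathematicalPhysics.QuantumFieldTheory.Balaban1983to89.B13FamilySum (coveringFamilies mem_coveringFamilies)
open Literature.MathematicalPhysics.QuantumFieldTheory.Balaban1983to89.TreeLengthTorus (TDom tsys torusTreeLen torusTreeLen_singleton)
open Literature.MathematicalPhysics.QuantumFieldTheory.Balaban1983to89.TreeLengthTorusGeometry (tgeometry TTouch)
open Summit.QuantumFields.BalabanUV.T4Continuum.B13HistMeasurable (B13HistM)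
open Summit.QuantumFields.BalabanUV.T4Continuum.B13HistWitness (toyFrame)
open Summit.QuantumFields.BalabanUV.T4Continuum.B13TermParamGaussianBi (BiCore)
open Summit.QuantumFields.BalabanUV.T4Continuum.NE1p.DressedSmallFieldTorusWitness (X₀ X₀_val eq_X₀_iff hrate_torus
  dressedConst_le_one exp_locE_cube)
open Summit.QuantumFields.BalabanUV.T4Continuum.NE1p.DressedSmallFieldGeometry (torus_consts)
open Summit.QuantumFields.BalabanUV.T4Continuum.NE1p.DressedSmallFieldGeometryFaces (K₀_four)
open Summit.QuantumFields.BalabanUV.T4Continuum.NE1p.DressedSmallFieldCoresWitness (E1 crd liveTable norm_liveTable_le coreW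
  N₁_coreW ctr0 hroom0 Acst Acst_pos hsmall_W incr integral_incr_pos)
open Summit.QuantumFields.BalabanUV.T4Continuum.NE1p.DressedSmallFieldCoresMassWitness (cM cM_pos letterMass_coreW hsmall_mu)
open Summit.QuantumFields.BalabanUV.T4Continuum.NE1p.DressedSmallFieldDepCoresWitness (budget_half termAt_coreW_pencil
  closedForm_real_sub_zero norm_term_le)
open Summit.QuantumFields.BalabanUV.T4Continuum.NE1p.DressedSmallFieldFamilyCount (count_coveringFamilies_geometry)
open Summit.QuantumFields.BalabanUV.T4Continuum.NE1p.DressedSmallFieldFamilyAmplitude (prod_radiusLetters_le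
  nonempty_of_mem_coveringFamilies attachedPart_locE_le_of_coresAt_pencil_radii muPart_locE_le_of_coresAt_pencil_families)

section Torus
variable (N : ℕ) [NeZero N] (r : ℝ) (hr : 0 ≤ r)

/-! ## §1 The located numerals (toy DATA, read off pv22's PROVED torus constants) -/

/-- print's `α₆`-slot at the torus (toy DATA): `α₆T := (e·K₀(64,8)·64)⁻¹` — TIGHT against `e·K₀·c₁·α₆ ≤ 1` at pv22's `K₀(64,8)`, `c₁ = 64`. [folklore] -/
def α₆T : ℝ := (Real.exp 1 * K₀ 64 8 * 64)⁻¹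

/-- `0 < α₆T`. [folklore] -/
theorem α₆T_pos : 0 < α₆T := by unfold α₆T; have := K₀_pos (64 : ℝ) 8; positivity
/-- The located `α₆`-slot is NINE times W24's located dressed constant `A = (e·K₀(64,8)·9·64)⁻¹` (the torus `ν = 9`). [folklore] -/
theorem α₆T_eq : α₆T = 9 * Acst := by
  unfold α₆T Acst; have := K₀_pos (64 : ℝ) 8; have := Real.exp_pos 1; field_simp

/-- print's `κ`-slot (toy DATA): `κT := 8·(κ₀ + 1)` — the least value meeting N0s's «κ large» clause `κ₀ + 1 ≤ δκ` at `δ = ⅛`. [folklore] -/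
def κT : ℝ := 8 * ((tgeometry 4 N).κ₀ + 1)

/-- print's amplitude slot (toy DATA): `θT := α₆T·e^{−5R}` at the located `R = 2κ₀ + 2` — TIGHT against `θe^{5R} ≤ α₆`. [folklore] -/
def θT : ℝ := α₆T * Real.exp (-(5 * (2 * (tgeometry 4 N).κ₀ + 2)))

/-- `0 < θT`. [folklore] -/
theorem θT_pos : 0 < θT N := by unfold θT; have := α₆T_pos; positivity
/-- **`hκ` TIGHT**: `κ₀ + 1 = ⅛·κT`. [folklore] -/
theorem hκ_T : (tgeometry 4 N).κ₀ + 1 ≤ (1 / 8 : ℝ) * κT N := by unfold κT; linarith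

/-- **`hRδ` WITH ROOM ⅗**: `R + δκ = 3(κ₀+1) ≤ 5(κ₀+1) = (1 − 3δ)κ` at `R = 2κ₀ + 2`, `δ = ⅛`. [folklore] -/
theorem hRδ_T : 2 * (tgeometry 4 N).κ₀ + 2 + (1 / 8 : ℝ) * κT N ≤ (1 - 3 * (1 / 8 : ℝ)) * κT N := by
  unfold κT; have := (tgeometry 4 N).κ₀_nonneg; nlinarith

/-- **`hclause` TIGHT**: `θT·e^{5R} = α₆T`. [folklore] -/
theorem hclause_T : θT N * Real.exp (5 * (2 * (tgeometry 4 N).κ₀ + 2)) ≤ α₆T := by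
  refine le_of_eq ?_
  unfold θT
  rw [show α₆T * Real.exp (-(5 * (2 * (tgeometry 4 N).κ₀ + 2))) * Real.exp (5 * (2 * (tgeometry 4 N).κ₀ + 2)) =
      α₆T * (Real.exp (-(5 * (2 * (tgeometry 4 N).κ₀ + 2))) * Real.exp (5 * (2 * (tgeometry 4 N).κ₀ + 2))) by ring,
    ← Real.exp_add, neg_add_cancel, Real.exp_zero, mul_one]

/-- The surviving amplitude factor is EXACTLY `1`: `θT·α₆T⁻¹·e^{5R} = 1`. [folklore] -/
theorem ampFactor_eq_one : θT N * α₆T⁻¹ * Real.exp (5 * (2 * (tgeometry 4 N).κ₀ + 2)) = 1 := by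
  unfold θT
  rw [show α₆T * Real.exp (-(5 * (2 * (tgeometry 4 N).κ₀ + 2))) * α₆T⁻¹ * Real.exp (5 * (2 * (tgeometry 4 N).κ₀ + 2)) =
      (α₆T * α₆T⁻¹) * (Real.exp (-(5 * (2 * (tgeometry 4 N).κ₀ + 2))) * Real.exp (5 * (2 * (tgeometry 4 N).κ₀ + 2))) by ring,
    mul_inv_cancel₀ α₆T_pos.ne', ← Real.exp_add, neg_add_cancel, Real.exp_zero, one_mul]

/-- **`h229` TIGHT**: `e·K₀·c₁·α₆T = 1` at pv22's torus letters (`K₀_four`, `torus_consts`). [folklore] -/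
theorem h229_T : Real.exp 1 * (tgeometry 4 N).K₀ * (tgeometry 4 N).c₁ * α₆T ≤ 1 := by
  rw [K₀_four, (torus_consts N).2.2]
  unfold α₆T
  have := K₀_pos (64 : ℝ) 8; have := Real.exp_pos 1
  exact le_of_eq (mul_inv_cancel₀ (by positivity))

/-! ## §2 The θ-form datum: per-family weights, one W33 core per covering family, all covering families as terms -/

/-- THE PER-FAMILY WEIGHT IN THE (2.15)∕(2.18) θ-FORM (toy DATA): `cT 𝐃 := cM r · Π_{Y∈𝐃} θT·e^{−(1−3δ)κT·d(Y)}`. [folklore] -/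
def cT (Df : Finset (TDom 4 N)) : ℝ :=
  cM r * ∏ Y ∈ Df, θT N * Real.exp (-((1 - 3 * (1 / 8 : ℝ)) * κT N * (tsys 4 N).dj Y))

/-- `0 < cT 𝐃`. [folklore] -/
theorem cT_pos (Df : Finset (TDom 4 N)) : 0 < cT N r Df :=
  mul_pos (cM_pos r) (Finset.prod_pos fun _ _ => mul_pos (θT_pos N) (Real.exp_pos _))
/-- THE CORE FAMILY (toy DATA): W33's one-label core at the family's θ-form weight — one core per covering family `𝐃`, at every step and
carrier domain. [folklore] -/
def GT : ∀ (_ : ℕ) (_ : Finset (TDom 4 N)), ℕ → BiCore toyFrame (fun _ : Unit => (0 : ℕ)) ℂ Unit E1 :=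
  fun _ Df _ => coreW (cT N r Df) r hr

open Classical in
/-- THE TERMS (toy DATA): ALL covering families of the polymer's own footprint — b13's `coveringFamilies` at the step's own scale
(`foot := id`; (B1b)'s residue DECIDED). [folklore] -/
def termsT (Z : TDom 4 N) : Finset (Finset (TDom 4 N)) :=
  coveringFamilies Finset.univ (tgeometry 4 N).cubes ((tgeometry 4 N).cubes Z)

/-- THE ACTIVITY OF RECORD (toy DATA): the sum of the families' terms along the pencil `s ↦ 0 + s • liveTable` (`hact` by `rfl` for the
table-strength AND the source pencil, `hscale` by `rfl`). [folklore] -/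
def actT (k : ℕ) (s : ℂ) (Z : TDom 4 N) : ℂ :=
  ∑ Df ∈ termsT N Z, (GT N r hr k Df k).termAt (0 : ℂ) ((0 : B13HistM toyFrame) + s • liveTable)

/-! ## §3 N0t's clauses MET on the datum -/

/-- **`hform` WITH `Gc := A`** [decided toy]: for EVERY polymer `Z` and EVERY family `𝐃`, the letter product of the core for `𝐃` at
W35's toy letters `(mq, bq, N₀) = (1, 0, 1)` and table radius `‖0‖ + ϱ‖liveTable‖`, `ϱ ≤ 2`, is `|cT 𝐃|·√(2π)·e^{r·ϱ‖liveTable‖} ≤ A·Π_{Y∈𝐃}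
θT·e^{−(1−3δ)κT d(Y)}` (W41's `budget_half` at `x = r`). [folklore] -/
theorem hform_T {ϱ : ℝ} (hϱ2 : ϱ ≤ 2) (k : ℕ) (Z : TDom 4 N) (Df : Finset (TDom 4 N)) :
    (GT N r hr k Df k).lam.real univ * ((GT N r hr k Df k).wB * (fun (_ : ℕ) (_ : Finset (TDom 4 N)) (_ : ℕ) => (1 : ℝ)) k Df k *
        Real.exp ((fun (_ : ℕ) (_ : Finset (TDom 4 N)) (_ : ℕ) => (0 : ℝ)) k Df k)) *
        (Real.pi / ((fun (_ : ℕ) (_ : Finset (TDom 4 N)) (_ : ℕ) => (1 : ℝ)) k Df k / 2)) ^ (Module.finrank ℝ E1 / 2 : ℝ) *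
      Real.exp ((GT N r hr k Df k).N₁ * (‖(0 : B13HistM toyFrame)‖ + ϱ * ‖liveTable‖)) ≤
    (fun _ : TDom 4 N => Acst) Z * ∏ Y ∈ Df, θT N * Real.exp (-((1 - 3 * (1 / 8 : ℝ)) * κT N * (tsys 4 N).dj Y)) := by
  have hP : 0 ≤ ∏ Y ∈ Df, θT N * Real.exp (-((1 - 3 * (1 / 8 : ℝ)) * κT N * (tsys 4 N).dj Y)) :=
    Finset.prod_nonneg fun _ _ => (mul_pos (θT_pos N) (Real.exp_pos _)).le
  have hu : ϱ * ‖liveTable‖ ≤ 2 := (mul_le_mul hϱ2 norm_liveTable_le (norm_nonneg _) (by norm_num)).trans (by norm_num)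
  have hb := budget_half r hr hu
  rw [abs_of_pos (half_pos (cM_pos r))] at hb
  show (coreW (cT N r Df) r hr).lam.real univ * ((coreW (cT N r Df) r hr).wB * 1 * Real.exp 0) *
      (Real.pi / (1 / 2)) ^ (Module.finrank ℝ E1 / 2 : ℝ) * Real.exp ((coreW (cT N r Df) r hr).N₁ * (‖(0 : B13HistM toyFrame)‖ + ϱ * ‖liveTable‖)) ≤
    Acst * ∏ Y ∈ Df, θT N * Real.exp (-((1 - 3 * (1 / 8 : ℝ)) * κT N * (tsys 4 N).dj Y))
  rw [letterMass_coreW, N₁_coreW, norm_zero, zero_add, abs_of_pos (cT_pos N r Df)]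
  unfold cT
  calc cM r * (∏ Y ∈ Df, θT N * Real.exp (-((1 - 3 * (1 / 8 : ℝ)) * κT N * (tsys 4 N).dj Y))) * Real.sqrt (2 * Real.pi) *
        Real.exp (r * (ϱ * ‖liveTable‖))
      = 2 * (cM r / 2 * Real.sqrt (2 * Real.pi) * Real.exp (r * (ϱ * ‖liveTable‖))) *
          ∏ Y ∈ Df, θT N * Real.exp (-((1 - 3 * (1 / 8 : ℝ)) * κT N * (tsys 4 N).dj Y)) := by ring
    _ ≤ 2 * (Acst / 2) * ∏ Y ∈ Df, θT N * Real.exp (-((1 - 3 * (1 / 8 : ℝ)) * κT N * (tsys 4 N).dj Y)) := by gcongr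
    _ = Acst * ∏ Y ∈ Df, θT N * Real.exp (-((1 - 3 * (1 / 8 : ℝ)) * κT N * (tsys 4 N).dj Y)) := by ring

/-- **`hamp` WITH EQUALITY** [decided toy]: `A·(θT·α₆T⁻¹·e^{5R}) = A = 0 + 2·(A∕2)`. [folklore] -/
theorem hamp_T (Z : TDom 4 N) :
    (fun _ : TDom 4 N => Acst) Z * (θT N * α₆T⁻¹ * Real.exp (5 * (2 * (tgeometry 4 N).κ₀ + 2))) ≤ 0 + 2 * (Acst / 2) := by
  show Acst * _ ≤ _; rw [ampFactor_eq_one]; linarith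

/-- Families covering a polymer's footprint are NONEMPTY (N0t's `nonempty_of_mem_coveringFamilies` + `cubes_nonempty`). [folklore] -/
theorem nonempty_of_mem_termsT {Z : TDom 4 N} {Df : Finset (TDom 4 N)} (h : Df ∈ termsT N Z) : Df.Nonempty := by
  unfold termsT at h
  exact nonempty_of_mem_coveringFamilies (S := Finset.univ) (cubesK := (tgeometry 4 N).cubes) ((tgeometry 4 N).cubes_nonempty Z) h

/-- `hterms` BY REFLEXIVITY: the terms ARE the covering families of the polymer's footprint at the step's own scale (`foot = id`). [folklore] -/
theorem hterms_T : ∀ Z : TDom 4 N, termsT N Z ⊆ coveringFamilies Finset.univ (tgeometry 4 N).cubes ((tgeometry 4 N).cubes Z) :=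
  fun Z => by unfold termsT; exact subset_rfl

/-- **(2.29)-FORM `hAmp` DERIVED FROM `hform`** [decided toy]: through N0t §2 `prod_radiusLetters_le` BY NAME (one amplitude factor, `= 1`
here, survives) — the letters of the core for a covering family are `≤ A·Π_{Y∈𝐃} α₆T e^{−δκT d(Y)}·e^{−R(d(Y)+5)}` at any `ϱ ≤ 2`. [folklore] -/
theorem hAmp_T {ϱ : ℝ} (hϱ2 : ϱ ≤ 2) (k : ℕ) (Z : TDom 4 N) {Df : Finset (TDom 4 N)} (hDf : Df ∈ termsT N Z) :
    (GT N r hr k Df k).lam.real univ * ((GT N r hr k Df k).wB * (fun (_ : ℕ) (_ : Finset (TDom 4 N)) (_ : ℕ) => (1 : ℝ)) k Df k *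
        Real.exp ((fun (_ : ℕ) (_ : Finset (TDom 4 N)) (_ : ℕ) => (0 : ℝ)) k Df k)) *
        (Real.pi / ((fun (_ : ℕ) (_ : Finset (TDom 4 N)) (_ : ℕ) => (1 : ℝ)) k Df k / 2)) ^ (Module.finrank ℝ E1 / 2 : ℝ) *
      Real.exp ((GT N r hr k Df k).N₁ * (‖(0 : B13HistM toyFrame)‖ + ϱ * ‖liveTable‖)) ≤
    Acst * ∏ Y ∈ Df, (α₆T * Real.exp (-((1 / 8 : ℝ) * κT N * (tsys 4 N).dj Y)) *
      Real.exp (-((2 * (tgeometry 4 N).κ₀ + 2) * ((tsys 4 N).dj Y + 5)))) := by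
  refine (hform_T N r hr hϱ2 k Z Df).trans ?_
  have hprod := prod_radiusLetters_le Df (nonempty_of_mem_termsT N hDf) (tsys 4 N).dj (θT_pos N).le α₆T_pos
    (fun Y _ => (tsys 4 N).dj_nonneg Y) (hRδ_T N) (hclause_T N)
  rw [ampFactor_eq_one, one_mul] at hprod
  exact mul_le_mul_of_nonneg_left hprod Acst_pos.le

/-! ## §4 THE ENDs FIRE: N0t's radii END and μ-families END applied ONCE EACH BY NAME -/

open Classical in
/-- **N0t's RADII END FIRES ON THE θ-FORM DATUM** [decided toy]: `attachedPart_locE_le_of_coresAt_pencil_radii (tsys 4 N) (tgeometry 4 N)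
(tgeometry 4 N) GT` with W33's `ctr0`∕`hroom0`, NE5's toy letters INLINE, the pencil's two radius inequalities, `hscale`∕`hact` by `rfl`,
W24's `hrate_torus` (so `R = 2κ₀ + 2`), W33's `hsmall_W`, `foot := id`, `hmono := le_rfl`, and §1∕§3's `α₆T_pos`, `hκ_T`, `h229_T`,
`hterms` by reflexivity, `hclause_T`, `hRδ_T`, `hamp_T`, `hform_T`; `hϱ : 2 ≤ 2`, `hϱA`.  Conclusion LITERAL. [folklore] -/
theorem radiiEnd_fires (k : ℕ) :
    ‖locE (tgeometry 4 N).ι (tgeometry 4 N).cubes (actT N r hr k 1) ((tgeometry 4 N).cubes (X₀ N)) -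
        locE (tgeometry 4 N).ι (tgeometry 4 N).cubes (actT N r hr k 0) ((tgeometry 4 N).cubes (X₀ N))‖ ≤
      4 * (Real.exp 1 * (tgeometry 4 N).ν * (tgeometry 4 N).c₁ * (tgeometry 4 N).K₀ ^ 2) * (Acst / 2) *
        Real.exp (-(0 * (tsys 4 N).dj (X₀ N))) :=
  attachedPart_locE_le_of_coresAt_pencil_radii (tsys 4 N) (tgeometry 4 N) (tgeometry 4 N) (GT N r hr)
    (W := Set.univ) (ctr := ctr0) (ROp := fun _ => 1) (RHist := fun _ => 2) (R' := fun _ => 2)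
    (mq := fun _ _ _ => 1) (bq := fun _ _ _ => 0) (N₀ := fun _ _ _ => 1)
    hroom0 (fun _ _ _ _ _ _ _ => one_pos)
    (fun _ _ _ _ _ _ _ => ⟨fun _ _ => aestronglyMeasurable_const, fun _ => differentiableOn_const _, fun _ _ _ => by
      show ‖(1 : ℂ)‖ ≤ 1; rw [norm_one]⟩)
    (fun _ _ _ _ _ _ _ => ⟨fun _ _ => (Complex.measurable_ofReal.comp (measurable_snd.norm.pow_const 2)).aestronglyMeasurable,
      fun _ _ => differentiableOn_const _, fun _ _ _ v => by
        show 1 * ‖v‖ ^ 2 - 0 ≤ (((‖v‖ ^ 2 : ℝ) : ℂ)).re; rw [Complex.ofReal_re]; simp⟩)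
    (g := fun _ => 0) (Set.mem_univ _) (U := ()) (o := 0) (h₀ := 0) (w := liveTable) (ϱ := 2)
    (by show ‖(0 : ℂ) - 0‖ ≤ 1; simp)
    (by show ‖(0 : B13HistM toyFrame) - 0‖ + 2 * ‖liveTable‖ ≤ 2; rw [sub_zero, norm_zero, zero_add];
        linarith [norm_liveTable_le])
    (emb := fun _ => k) (fun _ => rfl) (terms := termsT N) (act := actT N r hr k) (fun _ _ _ => rfl)
    (A₀ := 0) (A₁ := Acst / 2) (R := 2 * (tgeometry 4 N).κ₀ + 2) (r₁ := 0) (b₅ := 0) (X₀ := X₀ N)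
    le_rfl (by have := Acst_pos; positivity) le_rfl (by norm_num) (hrate_torus N) (hsmall_W N)
    (fun Z => Z) (fun _ => le_rfl) (δ := 1 / 8) (κ := κT N) (α₆ := α₆T) (θ := θT N) (Gc := fun _ => Acst)
    α₆T_pos (hκ_T N) (h229_T N) (hterms_T N) (θT_pos N).le (fun _ => Acst_pos.le) (hRδ_T N) (hclause_T N)
    (fun Z _ => hamp_T N Z) (fun Z _ Df _ => hform_T N r hr le_rfl k Z Df)
    le_rfl (by have := Acst_pos; linarith)

open Classical in
/-- … in CLOSED FORM: `≤ 2·K₀(64,8)` (pv22's constants BY NAME). [folklore] -/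
theorem radiiEnd_fires_closed (k : ℕ) :
    ‖locE (tgeometry 4 N).ι (tgeometry 4 N).cubes (actT N r hr k 1) ((tgeometry 4 N).cubes (X₀ N)) -
        locE (tgeometry 4 N).ι (tgeometry 4 N).cubes (actT N r hr k 0) ((tgeometry 4 N).cubes (X₀ N))‖ ≤ 2 * K₀ 64 8 := by
  refine (radiiEnd_fires N r hr k).trans (le_of_eq ?_)
  rw [(torus_consts N).1, (torus_consts N).2.2, K₀_four, zero_mul, neg_zero, Real.exp_zero, mul_one]
  unfold Acst
  have hK := K₀_pos (64 : ℝ) 8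
  have he := Real.exp_pos 1
  field_simp
  ring

open Classical in
/-- **N0t's μ-FAMILIES END FIRES ON THE SAME DATUM** [decided toy]: `muPart_locE_le_of_coresAt_pencil_families` ONCE BY NAME along the SOURCE
pencil `s ↦ 0 + s • liveTable` (`h₀ := 0`, `v := liveTable`, `‖s‖ < μ₁ ≤ 2`), the (2.29)-form amplitude `hAmp_T` at the constant `A`,
W35's `hsmall_mu`; for `0 < μ₀ < μ₁`, `‖μ‖ ≤ μ₀`.  Conclusion LITERAL. [folklore] -/
theorem muFamiliesEnd_fires {μ₁ μ₀ : ℝ} {μ : ℂ} (hμ₁ : μ₁ ≤ 2) (h0 : 0 < μ₀) (h01 : μ₀ < μ₁) (hμ : ‖μ‖ ≤ μ₀) (k : ℕ) :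
    ‖locE (tgeometry 4 N).ι (tgeometry 4 N).cubes (actT N r hr k μ) ((tgeometry 4 N).cubes (X₀ N)) -
        locE (tgeometry 4 N).ι (tgeometry 4 N).cubes (actT N r hr k 0) ((tgeometry 4 N).cubes (X₀ N))‖ ≤
      Real.exp 1 * (tgeometry 4 N).ν * (tgeometry 4 N).c₁ * (tgeometry 4 N).K₀ ^ 2 * Acst *
        Real.exp (-(0 * (tsys 4 N).dj (X₀ N))) * (μ₀ / (μ₁ - μ₀)) :=
  muPart_locE_le_of_coresAt_pencil_families (tsys 4 N) (tgeometry 4 N) (tgeometry 4 N) (GT N r hr)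
    (W := Set.univ) (ctr := ctr0) (ROp := fun _ => 1) (RHist := fun _ => 2) (R' := fun _ => 2)
    (mq := fun _ _ _ => 1) (bq := fun _ _ _ => 0) (N₀ := fun _ _ _ => 1)
    hroom0 (fun _ _ _ _ _ _ _ => one_pos)
    (fun _ _ _ _ _ _ _ => ⟨fun _ _ => aestronglyMeasurable_const, fun _ => differentiableOn_const _, fun _ _ _ => by
      show ‖(1 : ℂ)‖ ≤ 1; rw [norm_one]⟩)
    (fun _ _ _ _ _ _ _ => ⟨fun _ _ => (Complex.measurable_ofReal.comp (measurable_snd.norm.pow_const 2)).aestronglyMeasurable,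
      fun _ _ => differentiableOn_const _, fun _ _ _ v => by
        show 1 * ‖v‖ ^ 2 - 0 ≤ (((‖v‖ ^ 2 : ℝ) : ℂ)).re; rw [Complex.ofReal_re]; simp⟩)
    (g := fun _ => 0) (Set.mem_univ _) (U := ()) (o := 0) (h₀ := 0) (v := liveTable) (μ₁ := μ₁)
    (by show ‖(0 : ℂ) - 0‖ ≤ 1; simp)
    (by show ‖(0 : B13HistM toyFrame) - 0‖ + μ₁ * ‖liveTable‖ ≤ 2; rw [sub_zero, norm_zero, zero_add];
        exact (mul_le_mul hμ₁ norm_liveTable_le (norm_nonneg _) (by norm_num)).trans (by norm_num))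
    (emb := fun _ => k) (fun _ => rfl) (terms := termsT N) (act := actT N r hr k) (fun _ _ _ => rfl)
    (A := Acst) (R := 2 * (tgeometry 4 N).κ₀ + 2) (r₁ := 0) (b₅ := 0) (X₀ := X₀ N)
    Acst_pos.le le_rfl (by norm_num) (hrate_torus N) (hsmall_mu N)
    (fun Z => Z) (fun _ => le_rfl) (δ := 1 / 8) (κ := κT N) (α₆ := α₆T)
    α₆T_pos.le (hκ_T N) (h229_T N) (hterms_T N)
    (fun Z _ Df hDf => hAmp_T N r hr hμ₁ k Z hDf) h0 h01 hμ

/-! ## §5 GENUINE: the unit cube's own family is a term, the END's own count bounds the total weight, and both ENDs' quantities are NOT zero -/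

/-- **THE POLYMER'S OWN SINGLETON FAMILY IS A TERM**: `{X₀} ∈ termsT X₀` (b13's `mem_coveringFamilies`: `{X₀} ⊆ univ` and
`⋃_{Y∈{X₀}} cubes Y = cubes X₀`). [folklore] -/
theorem singleton_mem_termsT : {X₀ N} ∈ termsT N (X₀ N) := by
  unfold termsT
  exact mem_coveringFamilies.2 ⟨Finset.subset_univ _, Finset.singleton_biUnion⟩

/-- **THE END's OWN COUNT BOUNDS THE TOY's TOTAL WEIGHT** [decided toy]: `Σ_{𝐃 ∈ termsT Z} cT 𝐃 ≤ cM r·e^{−R d(Z)}` — N0t §2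
`prod_radiusLetters_le` termwise (surviving factor `1`) and N0s §2 `count_coveringFamilies_geometry` BY NAME (the (2.29) count of b13 on pv22's
torus, `foot = id`). [folklore] -/
theorem sum_cT_le (Z : TDom 4 N) :
    ∑ Df ∈ termsT N Z, cT N r Df ≤ cM r * Real.exp (-((2 * (tgeometry 4 N).κ₀ + 2) * (tsys 4 N).dj Z)) := by
  classical
  have hR : (0 : ℝ) ≤ 2 * (tgeometry 4 N).κ₀ + 2 := by linarith [(tgeometry 4 N).κ₀_nonneg]
  have hcount := count_coveringFamilies_geometry (D := tsys 4 N) (tgeometry 4 N) (fun Z => Z) (fun _ => le_rfl) α₆T_pos.le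
    (hκ_T N) (h229_T N) hR Z (hterms_T N Z)
  unfold cT
  rw [← Finset.mul_sum]
  refine mul_le_mul_of_nonneg_left (le_trans (Finset.sum_le_sum fun Df hDf => ?_) hcount) (cM_pos r).le
  have h := prod_radiusLetters_le Df (nonempty_of_mem_termsT N hDf) (tsys 4 N).dj (θT_pos N).le α₆T_pos
    (fun Y _ => (tsys 4 N).dj_nonneg Y) (hRδ_T N) (hclause_T N)
  rwa [ampFactor_eq_one, one_mul] at h

/-- At the unit cube the total weight is at most `cM r` (`d(X₀) = 0`). [folklore] -/
theorem sum_cT_X₀_le : ∑ Df ∈ termsT N (X₀ N), cT N r Df ≤ cM r := by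
  have h := sum_cT_le N r (X₀ N)
  have hd : (tsys 4 N).dj (X₀ N) = 0 := by show torusTreeLen (X₀ N).1 = 0; rw [X₀_val]; exact torusTreeLen_singleton 0
  rwa [hd, mul_zero, neg_zero, Real.exp_zero, mul_one] at h

/-- … and POSITIVE (the singleton family is present, every weight is positive). [folklore] -/
theorem sum_cT_X₀_pos : 0 < ∑ Df ∈ termsT N (X₀ N), cT N r Df :=
  Finset.sum_pos' (fun Df _ => (cT_pos N r Df).le) ⟨{X₀ N}, singleton_mem_termsT N, cT_pos N r _⟩

/-- **THE INCREMENT AT A REAL SOURCE `t` FACTORISES** [decided toy]: every family's term is W41's closed form at its own weight, so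
`act t X₀ − act 0 X₀ = (Σ_{𝐃} cT 𝐃)·∫ incr (t·r)` — ONE real integral times the total weight. [folklore] -/
theorem actT_real_sub_zero (k : ℕ) (t : ℝ) :
    actT N r hr k (t : ℂ) (X₀ N) - actT N r hr k 0 (X₀ N) =
      (((∑ Df ∈ termsT N (X₀ N), cT N r Df) * ∫ v, incr (t * r) v : ℝ) : ℂ) := by
  unfold actT GT
  rw [← Finset.sum_sub_distrib]
  simp only [termAt_coreW_pencil]
  rw [Finset.sum_congr rfl fun Df _ => closedForm_real_sub_zero (cT N r Df) r hr t]
  push_cast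
  rw [Finset.sum_mul]

/-- **THE μ-PART AT A REAL POSITIVE SOURCE IS NOT ZERO** (total weight `> 0`, W33's `∫ incr (t·r) > 0` for `0 < t`, `0 < r`). [folklore] -/
theorem actT_mu_live (hr0 : 0 < r) {t : ℝ} (ht : 0 < t) (k : ℕ) : actT N r hr k (t : ℂ) (X₀ N) ≠ actT N r hr k 0 (X₀ N) := by
  intro h
  have h0 := sub_eq_zero.2 h
  rw [actT_real_sub_zero] at h0
  have hre := Complex.ofReal_eq_zero.1 h0
  have hpos : 0 < (∑ Df ∈ termsT N (X₀ N), cT N r Df) * ∫ v, incr (t * r) v :=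
    mul_pos (sum_cT_X₀_pos N r) (integral_incr_pos _ (mul_pos ht hr0))
  linarith

/-- **THE ATTACHED PART IS NOT ZERO** — the source `t = 1`. [folklore] -/
theorem actT_live (hr0 : 0 < r) (k : ℕ) : actT N r hr k 1 (X₀ N) ≠ actT N r hr k 0 (X₀ N) := by
  simpa using actT_mu_live N r hr hr0 one_pos k

/-- The activities at `X₀` lie STRICTLY inside the unit disc for `‖s‖ ≤ 2`: total weight `≤ cM r = 2·(cM r∕2)` and W41's `norm_term_le`
per unit of weight (`A·√π∕√(2π) < 1`). [folklore] -/
theorem norm_actT_X₀_lt_one (k : ℕ) {s : ℂ} (hs : ‖s‖ ≤ 2) : ‖actT N r hr k s (X₀ N)‖ < 1 := by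
  unfold actT GT
  simp only [termAt_coreW_pencil]
  rw [← Finset.sum_mul, norm_mul]
  have hI := norm_term_le r hr hs
  rw [norm_mul, Complex.norm_real, Real.norm_eq_abs, abs_of_pos (half_pos (cM_pos r))] at hI
  have hS : ‖∑ Df ∈ termsT N (X₀ N), (cT N r Df : ℂ)‖ ≤ cM r := by
    rw [← Complex.ofReal_sum, Complex.norm_real, Real.norm_eq_abs, abs_of_pos (sum_cT_X₀_pos N r)]
    exact sum_cT_X₀_le N r
  have hπ : 0 < Real.sqrt Real.pi := Real.sqrt_pos.2 Real.pi_pos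
  have hlt : Real.sqrt Real.pi < Real.sqrt (2 * Real.pi) := Real.sqrt_lt_sqrt Real.pi_pos.le (by linarith [Real.pi_pos])
  have hq : Real.sqrt Real.pi / Real.sqrt (2 * Real.pi) < 1 := (div_lt_one (hπ.trans hlt)).2 hlt
  have hA : Acst ≤ 1 := dressedConst_le_one
  have hJ : ‖∫ v : E1, cexp (s * ((r : ℂ) * (Real.exp (-(crd v ^ 2)) : ℂ))) * cexp (-(((‖v‖ ^ 2 : ℝ) : ℂ)))‖ ≤
      (Acst / 2 * (Real.sqrt Real.pi / Real.sqrt (2 * Real.pi))) / (cM r / 2) := by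
    rw [le_div_iff₀ (half_pos (cM_pos r))]; linarith [hI]
  calc ‖∑ Df ∈ termsT N (X₀ N), (cT N r Df : ℂ)‖ *
        ‖∫ v : E1, cexp (s * ((r : ℂ) * (Real.exp (-(crd v ^ 2)) : ℂ))) * cexp (-(((‖v‖ ^ 2 : ℝ) : ℂ)))‖
      ≤ cM r * ((Acst / 2 * (Real.sqrt Real.pi / Real.sqrt (2 * Real.pi))) / (cM r / 2)) :=
        mul_le_mul hS hJ (norm_nonneg _) (cM_pos r).le
    _ = Acst * (Real.sqrt Real.pi / Real.sqrt (2 * Real.pi)) := by have := (cM_pos r).ne'; field_simp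
    _ < 1 := by have := Acst_pos; nlinarith

open Classical in
/-- **THE μ-END's BOUNDED QUANTITY IS NOT ZERO** for a REAL source `0 < t ≤ 2` [decided toy] (W24 `exp_locE_cube`). [folklore] -/
theorem muFamiliesEnd_live (hr0 : 0 < r) {t : ℝ} (ht : 0 < t) (ht2 : t ≤ 2) (k : ℕ) :
    locE (tgeometry 4 N).ι (tgeometry 4 N).cubes (actT N r hr k (t : ℂ)) ((tgeometry 4 N).cubes (X₀ N)) ≠
      locE (tgeometry 4 N).ι (tgeometry 4 N).cubes (actT N r hr k 0) ((tgeometry 4 N).cubes (X₀ N)) := by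
  intro h
  have ht' : ‖(t : ℂ)‖ ≤ 2 := by rw [Complex.norm_real, Real.norm_eq_abs, abs_of_pos ht]; exact ht2
  have h1 := exp_locE_cube N (w := actT N r hr k (t : ℂ)) (norm_actT_X₀_lt_one N r hr k ht')
  have h0 := exp_locE_cube N (w := actT N r hr k 0) (norm_actT_X₀_lt_one N r hr k (by simp))
  have h' : cexp (locE (TTouch (d := 4) (N := N)) (fun Z : (tsys 4 N).Dom => Z.1) (actT N r hr k (t : ℂ)) {0}) =
      cexp (locE (TTouch (d := 4) (N := N)) (fun Z : (tsys 4 N).Dom => Z.1) (actT N r hr k 0) {0}) := congrArg cexp h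
  rw [h1, h0, add_right_inj] at h'
  exact actT_mu_live N r hr hr0 ht k h'

open Classical in
/-- **THE RADII END's BOUNDED QUANTITY IS NOT ZERO** — the source `t = 1`. [folklore] -/
theorem radiiEnd_live (hr0 : 0 < r) (k : ℕ) :
    locE (tgeometry 4 N).ι (tgeometry 4 N).cubes (actT N r hr k 1) ((tgeometry 4 N).cubes (X₀ N)) ≠
      locE (tgeometry 4 N).ι (tgeometry 4 N).cubes (actT N r hr k 0) ((tgeometry 4 N).cubes (X₀ N)) := by
  simpa using muFamiliesEnd_live N r hr hr0 one_pos (by norm_num : (1 : ℝ) ≤ 2) k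

end Torus

end Summit.QuantumFields.BalabanUV.T4Continuum.NE1p.DressedSmallFieldRadiiWitness

end
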